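import Summits.CriticalPhenomena.PercolationContinuityZ3.Theorems.PercNearOneGluingNoHeavyQuantSliceTwoRowRates
import Summits.CriticalPhenomena.PercolationContinuityZ3.Theorems.PercNearOneGluingNoHeavyQuantLawDecUsageMonge
import HarnessLib

/-!
# QUANT lane R8, T-DEC: rates under the GATED SHIFT — shifted pairs are cheaper, staying zero pairs are cheaper iff the absorber is at most `S/q`
# (part 1 of 3 of the shift transport for Conjecture R `LawDec.GatedShiftDEC`)

builds on p205010 (kernel theorem, internal audit signed; external expert review pending)

Support file (`--supports stmt-CriticalPhenomena-4575`), QUANT lane typer seat prim-quant-stmt (gen 25), rung R8 of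
`run/shared/lean/prim/quant/LADDER.md`; memo `run/shared/lean/prim/quant/prim-quant-stmt-g25/GATE-INTERACTION-G25.md` §4.  Theorems only,
standard axioms, no sorries.  Parts 2–3: `…QuantGatedShiftTransport` (the flow transport `flowAtT_gatedShift`), `…QuantGatedShiftSubMean`
(Conjecture R for laws with no atom strictly between mean and top).

When every pair `(l, h)` of a DEC flow at `(y, S, J)` is moved to `(l+k, h+k)` and the target to `S + q·k` (`q ≤ 2`), the `ρ = (T − 2l)/(h − l)` of
a mid pair DECREASES (`(S + qk − 2l − 2k)/(h − l) ≤ (S − 2l)/(h − l)`), so its minimal gate (`pairGate_mono_rho`, lead g21) and its usage decrease;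
giants stay giants with usage `y/(1−y)`.  A zero pair whose low end STAYS at `0`, `(0, h) ↦ (0, h+k)`, has `ρ' = (S + qk)/(h + k) ≤ S/h` iff
`h·q ≤ S`: the only pairs that get more expensive under the gated shift are the staying zero pairs into mids above `S/q` (= the mean of the
ungated law).

* **`usage_shift_le`** — `usage y (S + qk) (J + k) (l + k) (h + k) ≤ usage y S J l h` for an admissible pair (`2l < S`, `l < h`, giant or `S < l + h`), `q ≤ 2`.
* **`usage_stay_le`** — `usage y (S + qk) (J + k) 0 (h + k) ≤ usage y S J 0 h` for an admissible zero pair with `h·q ≤ S` when `h` is a mid.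

[this work]; flow normal form / rates: this lane (typer g22, lead g21).  The gluing rows served [cite: KozmaNitzan2024, Conjecture 3 (p. 15)];
product measure [cite: Grimmett1999, §1.3 p. 10].
-/

noncomputable section

namespace Summit.CriticalPhenomena.PercolationContinuityZ3.Theorems

namespace Quant

open Finset

namespace LawDec

/-! ### Rates under the shift -/

/-- **shifted pairs are cheaper**: for a `ν`-admissible pair `(l, h)` at `(y, S, J)` (`2l < S`, `l < h`, giant or compatible mid) and `q·k ≤ 2k`,
the pair `(l+k, h+k)` at `(y, S + qk, J + k)` has usage at most that of `(l, h)`. [this work] -/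
theorem usage_shift_le (y S q : ℝ) (J k l h : ℕ) (hy0 : 0 < y) (hy1 : y < 1) (hq : q ≤ 2) (hlow : 2 * (l : ℝ) < S) (hlh : l < h)
    (hadm : J + 1 ≤ h ∨ S < (l : ℝ) + h) :
    usage y (S + q * k) (J + k) (l + k) (h + k) ≤ usage y S J l h := by
  by_cases hg : J + 1 ≤ h
  · rw [usage_giant_eq y _ _ _ _ (by omega : J + k + 1 ≤ h + k), usage_giant_eq y S J l h hg]
  · have hcomp : S < (l : ℝ) + h := by
      rcases hadm with h1 | h2
      · exact absurd h1 hg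
      · exact h2
    have hng' : ¬ (J + k + 1 ≤ h + k) := by omega
    simp only [usage, gateOf, if_neg hg, if_neg hng']
    have hd : (0 : ℝ) < (h : ℝ) - l := by
      have : (l : ℝ) < h := by exact_mod_cast hlh
      linarith
    have hρ : (S + q * k - 2 * ((l + k : ℕ) : ℝ)) / (((h + k : ℕ) : ℝ) - ((l + k : ℕ) : ℝ)) ≤ (S - 2 * (l : ℝ)) / ((h : ℝ) - l) := by
      push_cast
      rw [show (h : ℝ) + k - (l + k) = (h : ℝ) - l by ring, div_le_div_iff_of_pos_right hd]
      nlinarith [(Nat.cast_nonneg k : (0 : ℝ) ≤ k)]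
    have mono : ∀ {a b : ℝ}, a ≤ b → b < 1 → a / (1 - a) ≤ b / (1 - b) := by
      intro a b hab hb
      have ha : 0 < 1 - a := by linarith
      have hb' : 0 < 1 - b := by linarith
      rw [div_le_div_iff₀ ha hb']
      nlinarith
    exact mono (pairGate_mono_rho y _ _ _ _ _ _ hy1.le hρ) (pairGate_lt_one y S l h hy0 hy1 hlow hcomp)

/-- **staying zero pairs are cheaper iff the absorber is at most `S/q`**: for a `ν`-admissible pair `(0, h)` (giant, or mid with `S < h`) with
`h·q ≤ S` in the mid case, the pair `(0, h+k)` at `(y, S + qk, J + k)` has usage at most that of `(0, h)`. [this work] -/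
theorem usage_stay_le (y S q : ℝ) (J k h : ℕ) (hy0 : 0 < y) (hy1 : y < 1) (hS : 0 < S) (hh : 0 < h)
    (hadm : J + 1 ≤ h ∨ S < (h : ℝ)) (hstay : h ≤ J → (h : ℝ) * q ≤ S) :
    usage y (S + q * k) (J + k) 0 (h + k) ≤ usage y S J 0 h := by
  by_cases hg : J + 1 ≤ h
  · rw [usage_giant_eq y _ _ _ _ (by omega : J + k + 1 ≤ h + k), usage_giant_eq y S J 0 h hg]
  · have hcomp : S < (h : ℝ) := by
      rcases hadm with h1 | h2
      · exact absurd h1 hg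
      · exact h2
    have hqS : (h : ℝ) * q ≤ S := hstay (by omega)
    have hng' : ¬ (J + k + 1 ≤ h + k) := by omega
    simp only [usage, gateOf, if_neg hg, if_neg hng']
    have hh' : (0 : ℝ) < h := by exact_mod_cast hh
    have hρ : (S + q * k - 2 * ((0 : ℕ) : ℝ)) / (((h + k : ℕ) : ℝ) - ((0 : ℕ) : ℝ)) ≤ (S - 2 * ((0 : ℕ) : ℝ)) / ((h : ℝ) - ((0 : ℕ) : ℝ)) := by
      push_cast
      simp only [mul_zero, sub_zero]
      have hk0 : (0 : ℝ) ≤ k := Nat.cast_nonneg k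
      rw [div_le_div_iff₀ (by linarith) hh']
      nlinarith
    have hlt1 := pairGate_lt_one y S 0 h hy0 hy1 (by simpa using hS) (by simpa using hcomp)
    have mono : ∀ {a b : ℝ}, a ≤ b → b < 1 → a / (1 - a) ≤ b / (1 - b) := by
      intro a b hab hb
      have ha : 0 < 1 - a := by linarith
      have hb' : 0 < 1 - b := by linarith
      rw [div_le_div_iff₀ ha hb']
      nlinarith
    exact mono (pairGate_mono_rho y _ _ _ _ _ _ hy1.le hρ) hlt1

end LawDec

end Quant

end Summit.CriticalPhenomena.PercolationContinuityZ3.Theorems
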